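/-
Copyright (c) 2026 the pub-hodgecm-mathlib formalisation cell (harness21).  Prover seat hodgecm-mathlib-K2Liu-p07 (g2): Track B «K2-LIT»,
#184♮ = hLiu418 = stmt-HodgeConjecture-24832; LEAD F0P6-plan (g10) DEAL 2026-09-03T23:43:04Z «B2» (organ O41.1 part B2 of socket #41
`sig_K2LiuSiegelEisensteinContinuation`; p02's sketch 23:22:00Z); REPORT-FIRST B2 `K2/K2Liu-p07/g2/REPORT-FIRST-B2-SiegelBruhatMiddleCell.K2Liup07g2.md`
6770f1399d2dee2a, file B2a; 2026-09-04.
-/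
import Summits.HodgeConjecture.HodgeConjecture.Theorems.K2LiuSiegelBruhatCells
import HarnessLib

/-!
# Crux `HLiu418`, road `K2_Liu`, organ O41.1 part B2 (file B2a): the REFLECTION CELLS of the Siegel parabolic in block-matrix form —
# the frame `W_E = (1 0; −2E, 1 − 2E)` of `w_E = ι(1, 1 − 2E)`, the corner condition `E X E = 0`, and the parabolic `P_Δ ∩ w_E⁻¹ P_Δ w_E = B_E · N_E`

Cell `hodgecm-mathlib`, crux item hLiu418 = `stmt-HodgeConjecture-24832`; prover K2Liu-p07 (g2) continuing K2Liu-p02 (g0)'s organ O41.1 (★ part A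
`K2LiuSiegelBruhatCells`: cell invariance of the lower-left block `C`, the small cell `C = 0`, the big cell `C` invertible).  THEOREMS ONLY, imports = ★ part A
(Mathlib block algebra), lane `--supports stmt-HodgeConjecture-24832 --as helper`.

SETTING (the triangular frame of ★ `conjE_eq`: `E₁ · blk h · E₂ = (A B; C D)`, `P_Δ = {C = 0}`, `N_Δ = {(1 X; 0 1)}`, Siegel frames `(a b; 0 d)`).
For an IDEMPOTENT `E` (`E² = E`; over a field: a projector of rank `r`) the unitary REFLECTION `g_E = 1 − 2E ∈ U(V)` (for `E` the `T`-orthogonal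
projector on a non-isotropic subspace — e.g. `E = e_{i₀} e_{i₀}ᵀ`, `g_E = diag(1,…,−1,…,1)` for the diagonal `dV`) gives `w_E := ι(1, g_E) ∈ H(L⁺)` with
frame **`W_E = (1, 0; −2E, 1 − 2E)`** (★ `conjE_eq` on `diag(1, g_E)`: `C = g_E − 1 = −2E`, `D = g_E`); `E = 1` is the big-cell element `w_Δ`
(`W_1 = (1 0; −2 −1)` = ★ part A's `W`), `E = 0` the identity, and `rank E = 1` (n = 2: `E = e₂e₂ᵀ`) the MIDDLE cell of `P_Δ\H/P_Δ ↔ rank C ∈ {0,1,2}`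
— p02's sketch «`w_r := ι(1, g_r)`, frame `(1 0; g_r − 1, g_r)`, `rank(g_r − 1) = r`».  Over a commutative ring `R` (with `⅟2` where stated):
* §1 `reflFrame_mul_self`: `W_E² = 1` (so `w_E² = 1`, `w_E⁻¹ = w_E`); `toBlocks₂₁_reflFrame = −2E` (the cell of `w_E` is `rank E`).
* §2 **`toBlocks₂₁_reflFrame_mul_unip_mul_reflFrame`**: the corner of `W_E (1 X; 0 1) W_E` is `4EXE`; hence (`⅟2`)
  **`reflConj_unip_siegel_iff`: `w_E n(X) w_E ∈ P_Δ ⟺ E X E = 0`** — the CORNER CONDITION cutting out `N_E := N_Δ ∩ w_E⁻¹ P_Δ w_E`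
  (for `E = e_{i₀}e_{i₀}ᵀ`: `X_{i₀ i₀} = 0`, a hyperplane in `N_Δ ≅ Herm_n`); this is the STABILISER of the coset `P_Δ w_E` under the right
  `N_Δ`-action, the datum O41.4 v2 («MID») integrates over `N_E(L⁺)\N_Δ(𝔸)`.
* §3 **`toBlocks₂₁_reflFrame_mul_siegel_mul_reflFrame`** and **`reflConj_siegel_siegel_iff`**: for a Siegel frame `S = (a b; 0 d)`,
  `w_E S w_E ∈ P_Δ ⟺ E a (1 − E) = 0 ∧ (1 − E) d E = 0 ∧ 2·E b E = E (a − d) E` — i.e. **`P_Δ ∩ w_E⁻¹ P_Δ w_E`** in frame coordinates.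
* §4 THE LEVI.  In this frame the Levi `M_Δ` (stabiliser of `Δ` AND of `Δ⁻ = {(x, −x)}`, whose frame image is `{(x, −2x)}`) consists of the frames
  **`ℓ(a, d) = (a, ⅟2(a − d); 0, d)`** (`leviFrame_apply_antidiag`: such a frame maps `(x; −2x)` to `(dx; −2dx)`, i.e. preserves `{(x, −2x)}`;
  unitarity then forces `d = T⁻¹(a*)⁻¹T`, not used here), and for them the third condition of §3 is AUTOMATIC: **`reflConj_leviFrame_siegel_iff`:
  `w_E ℓ(a,d) w_E ∈ P_Δ ⟺ E a (1 − E) = 0 ∧ (1 − E) d E = 0`** — the parabolic **`B_E := M_Δ ∩ w_E⁻¹ P_Δ w_E`** of the Levi: `a` stabilises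
  the subspace `ker E` («row `i₀` of `a` is `a_{i₀i₀} e_{i₀}ᵀ`») and `d` the subspace `im E`; for `n = 2`, `rank E = 1` this is a BOREL of
  `M_Δ(L⁺) ≅ GL₂(L)` — the index group of O41.4's middle term `E₁(s) = Σ_{B_E(L⁺)\M_Δ(L⁺)} …` and of O41.8's `GL₂` Eisenstein series.
* §5 **`reflConj_leviFrame_mul_unip_siegel_iff`**: `w_E (ℓ(a,d) · n(X)) w_E ∈ P_Δ ⟺ [B_E-conditions] ∧ E a X E = 0` — with §2 this is
  `P_Δ ∩ w_E⁻¹P_Δ w_E = B_E · N_E` once `E a E` is invertible on `im E` (then `E a X E = 0 ⟺ E X E = 0`; recorded as `corner_factor`: `E a X E = (E a E)(E X E)`), the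
  decomposition behind «orbits of the middle cell ≅ B_E\M_Δ, stabilisers `m⁻¹ N_E m`» (REPORT-FIRST B2 (C2)–(C3)); and
  `toBlocks₂₁_reflFrame_mul_siegel` ∕ `toBlocks₂₁_siegel_mul_reflFrame`: the corner of `w_E · (a b; 0 d)` is `−2 E a` (of `(a b; 0 d) · w_E`: `−2 d E`) (rank `= rank E` for invertible `a`: the representatives
  `w_E m` stay in the `rank E` cell).
The TRANSPORT to `H(𝔸)`/`H(L⁺)` (★ D9 `conjE`-frames, `w_E ∈ H(L⁺)` à la ★ `K2LiuWeylDeltaRational`) and the EXHAUSTION «rank C = 1 ⇒ P_Δ w_E P_Δ»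
(n = 2) are files B2b/B2c.  [GelbartPiatetskishapiroRallis1987, Part A §§1–2], [KudlaRallis1994, §1], [MoeglinWaldspurger1995, II.1.7].
HONEST LABEL.  Count-neutral helper; `HC_CM` is proved only modulo the 7 printed citations (hLiu418 = 24832, h413 = 24833) until rung 0 closes.
-/

set_option autoImplicit false
set_option linter.dupNamespace false -- the mandated namespace repeats `HodgeConjecture.HodgeConjecture`

namespace Summit.HodgeConjecture.HodgeConjecture.Cruxes.HLiu418.K2LiuSiegelBruhatMiddleCell

open Matrix

variable {R : Type*} [CommRing R] {m : Type*} [Fintype m] [DecidableEq m]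

/-! ## §0 Idempotent calculus and the four-corner («sandwich») decomposition -/

omit [DecidableEq m] in
/-- `E (E Z) = E Z` for an idempotent `E` (right-associated form of `E² = E`, for `simp`). [folklore] -/
theorem idem_mul_assoc {E : Matrix m m R} (hE : E * E = E) (Z : Matrix m m R) : E * (E * Z) = E * Z := by
  rw [← Matrix.mul_assoc, hE]

/-- **Four-corner decomposition**: `Y = EYE + EY(1−E) + (1−E)YE + (1−E)Y(1−E)` for ANY `E`. [folklore] -/
theorem sandwich_decomp (E Y : Matrix m m R) :
    Y = E * Y * E + E * Y * (1 - E) + (1 - E) * Y * E + (1 - E) * Y * (1 - E) := by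
  simp only [Matrix.mul_sub, Matrix.sub_mul, Matrix.mul_one, Matrix.one_mul]
  module

/-- … so `Y = 0` iff its four corners vanish. [folklore] -/
theorem eq_zero_iff_sandwich (E Y : Matrix m m R) :
    Y = 0 ↔ E * Y * E = 0 ∧ E * Y * (1 - E) = 0 ∧ (1 - E) * Y * E = 0 ∧ (1 - E) * Y * (1 - E) = 0 := by
  constructor
  · rintro rfl
    simp
  · rintro ⟨h1, h2, h3, h4⟩
    rw [sandwich_decomp E Y, h1, h2, h3, h4, add_zero, add_zero, add_zero]

/-- `(1 − 2E)² = 1`: the reflection `g_E = 1 − 2E` is an involution. [folklore] -/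
theorem refl_mul_refl {E : Matrix m m R} (hE : E * E = E) : (1 - (2 : R) • E) * (1 - (2 : R) • E) = 1 := by
  simp only [Matrix.sub_mul, Matrix.mul_sub, Matrix.one_mul, Matrix.mul_one, Matrix.smul_mul, Matrix.mul_smul, hE]
  module

/-! ## §1 The reflection frame `W_E = (1, 0; −2E, 1 − 2E)` -/

/-- **`W_E² = 1`** — `w_E = ι(1, 1 − 2E)` is an involution (for `E = 1`: ★ D9 `weylDelta_mul_weylDelta`). [cite: GelbartPiatetskishapiroRallis1987, Part A §1] -/
theorem reflFrame_mul_self {E : Matrix m m R} (hE : E * E = E) :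
    fromBlocks (1 : Matrix m m R) 0 (-((2 : R) • E)) (1 - (2 : R) • E) * fromBlocks 1 0 (-((2 : R) • E)) (1 - (2 : R) • E) = 1 := by
  rw [fromBlocks_multiply, ← fromBlocks_one, fromBlocks_inj]
  refine ⟨by simp, by simp, ?_, ?_⟩
  · simp only [Matrix.one_mul, Matrix.mul_one, Matrix.mul_neg, Matrix.sub_mul, Matrix.smul_mul, Matrix.mul_smul, hE]
    module
  · simp only [Matrix.mul_zero, zero_add, refl_mul_refl hE]

omit [Fintype m] in
/-- The cell of `w_E`: the lower-left block of `W_E` is `−2E` (rank `= rank E` when `2 ∈ Rˣ`). [cite: GelbartPiatetskishapiroRallis1987, Part A §1] -/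
theorem toBlocks₂₁_reflFrame (E : Matrix m m R) :
    (fromBlocks (1 : Matrix m m R) 0 (-((2 : R) • E)) (1 - (2 : R) • E)).toBlocks₂₁ = -((2 : R) • E) :=
  toBlocks_fromBlocks₂₁ _ _ _ _

/-! ## §2 Conjugating `N_Δ`: the corner condition `E X E = 0` -/

/-- **The corner of `W_E · (1 X; 0 1) · W_E` is `4 E X E`.** [cite: GelbartPiatetskishapiroRallis1987, Part A §1] -/
theorem toBlocks₂₁_reflFrame_mul_unip_mul_reflFrame {E : Matrix m m R} (hE : E * E = E) (X : Matrix m m R) :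
    (fromBlocks (1 : Matrix m m R) 0 (-((2 : R) • E)) (1 - (2 : R) • E) * fromBlocks 1 X 0 1 *
        fromBlocks 1 0 (-((2 : R) • E)) (1 - (2 : R) • E)).toBlocks₂₁ = (4 : R) • (E * X * E) := by
  rw [fromBlocks_multiply, fromBlocks_multiply, toBlocks_fromBlocks₂₁]
  simp only [Matrix.one_mul, Matrix.mul_one, Matrix.mul_zero, add_zero, Matrix.add_mul, Matrix.sub_mul, Matrix.mul_neg, Matrix.neg_mul,
    Matrix.mul_smul, Matrix.smul_mul, Matrix.mul_assoc, hE]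
  module

/-- **THE CORNER CONDITION: `w_E · n(X) · w_E ∈ P_Δ ⟺ E X E = 0`** (`2 ∈ Rˣ`) — the stabiliser `N_E = N_Δ ∩ w_E⁻¹ P_Δ w_E` of the coset `P_Δ w_E` under the
right `N_Δ`-action; for `E = e_{i₀}e_{i₀}ᵀ` the hyperplane `X_{i₀ i₀} = 0` of `N_Δ` (for `E = 1`: `X = 0`, the big cell is free — ★ p855538).
[cite: MoeglinWaldspurger1995, II.1.7] [cite: GelbartPiatetskishapiroRallis1987, Part A §§1–2] -/
theorem reflConj_unip_siegel_iff [Invertible (2 : R)] {E : Matrix m m R} (hE : E * E = E) (X : Matrix m m R) :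
    (fromBlocks (1 : Matrix m m R) 0 (-((2 : R) • E)) (1 - (2 : R) • E) * fromBlocks 1 X 0 1 *
        fromBlocks 1 0 (-((2 : R) • E)) (1 - (2 : R) • E)).toBlocks₂₁ = 0 ↔ E * X * E = 0 := by
  rw [toBlocks₂₁_reflFrame_mul_unip_mul_reflFrame hE]
  refine ⟨fun h => ?_, fun h => by rw [h, smul_zero]⟩
  have h' : ((⅟ (2 : R) * ⅟ (2 : R)) * (4 : R)) • (E * X * E) = 0 := by rw [← smul_smul, h, smul_zero]
  have h1 : (⅟ (2 : R) * ⅟ (2 : R)) * (4 : R) = 1 := by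
    rw [show (4 : R) = 2 * 2 by norm_num, mul_assoc, ← mul_assoc (⅟ (2 : R)) 2 2, invOf_mul_self, one_mul, invOf_mul_self]
  rwa [h1, one_smul] at h'

/-! ## §3 Conjugating a Siegel frame: `P_Δ ∩ w_E⁻¹ P_Δ w_E` in frame coordinates -/

/-- **The corner of `W_E · (a b; 0 d) · W_E` is `−2Ea + 4EbE − 2dE + 4EdE`.** [cite: GelbartPiatetskishapiroRallis1987, Part A §1] -/
theorem toBlocks₂₁_reflFrame_mul_siegel_mul_reflFrame (E a b d : Matrix m m R) :
    (fromBlocks (1 : Matrix m m R) 0 (-((2 : R) • E)) (1 - (2 : R) • E) * fromBlocks a b 0 d *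
        fromBlocks 1 0 (-((2 : R) • E)) (1 - (2 : R) • E)).toBlocks₂₁ =
      -((2 : R) • (E * a)) + (4 : R) • (E * b * E) - (2 : R) • (d * E) + (4 : R) • (E * d * E) := by
  rw [fromBlocks_multiply, fromBlocks_multiply, toBlocks_fromBlocks₂₁]
  simp only [Matrix.one_mul, Matrix.mul_one, Matrix.mul_zero, add_zero, Matrix.add_mul, Matrix.sub_mul, Matrix.mul_neg, Matrix.neg_mul,
    Matrix.mul_smul, Matrix.smul_mul, Matrix.mul_assoc]
  module

/-- The four corners of `Y = −2Ea + 4EbE − 2dE + 4EdE`: `E Y (1−E) = −2 E a (1−E)`, `(1−E) Y E = −2 (1−E) d E`,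
`E Y E = −2EaE + 4EbE + 2EdE`, `(1−E) Y (1−E) = 0`. [folklore] -/
theorem sandwich_corner {E : Matrix m m R} (hE : E * E = E) (a b d : Matrix m m R) :
    E * (-((2 : R) • (E * a)) + (4 : R) • (E * b * E) - (2 : R) • (d * E) + (4 : R) • (E * d * E)) * (1 - E) = -((2 : R) • (E * a * (1 - E))) ∧
    (1 - E) * (-((2 : R) • (E * a)) + (4 : R) • (E * b * E) - (2 : R) • (d * E) + (4 : R) • (E * d * E)) * E = -((2 : R) • ((1 - E) * d * E)) ∧
    E * (-((2 : R) • (E * a)) + (4 : R) • (E * b * E) - (2 : R) • (d * E) + (4 : R) • (E * d * E)) * E =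
      -((2 : R) • (E * a * E)) + (4 : R) • (E * b * E) + (2 : R) • (E * d * E) ∧
    (1 - E) * (-((2 : R) • (E * a)) + (4 : R) • (E * b * E) - (2 : R) • (d * E) + (4 : R) • (E * d * E)) * (1 - E) = 0 := by
  refine ⟨?_, ?_, ?_, ?_⟩ <;>
  · simp only [Matrix.mul_add, Matrix.add_mul, Matrix.mul_sub, Matrix.sub_mul, Matrix.mul_neg, Matrix.neg_mul, Matrix.mul_smul,
      Matrix.smul_mul, Matrix.mul_assoc, Matrix.mul_one, Matrix.one_mul, hE, idem_mul_assoc hE]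
    module

omit [Fintype m] [DecidableEq m] in
/-- `−2 Z = 0 ⟹ Z = 0` when `2 ∈ Rˣ`. [folklore] -/
theorem eq_zero_of_neg_two_smul_eq_zero [Invertible (2 : R)] {Z : Matrix m m R} (h : -((2 : R) • Z) = 0) : Z = 0 := by
  have h' : (⅟ (2 : R)) • ((2 : R) • Z) = 0 := by rw [neg_eq_zero.1 h, smul_zero]
  rwa [smul_smul, invOf_mul_self, one_smul] at h'

/-- **`P_Δ ∩ w_E⁻¹ P_Δ w_E` IN FRAME COORDINATES** (`2 ∈ Rˣ`): for a Siegel frame `S = (a b; 0 d)`,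
`w_E S w_E ∈ P_Δ ⟺ E a (1 − E) = 0 ∧ (1 − E) d E = 0 ∧ 2·(E b E) = E a E − E d E`  (the four corners of §0 applied to the corner of §3).
[cite: MoeglinWaldspurger1995, II.1.7] [cite: GelbartPiatetskishapiroRallis1987, Part A §§1–2] -/
theorem reflConj_siegel_siegel_iff [Invertible (2 : R)] {E : Matrix m m R} (hE : E * E = E) (a b d : Matrix m m R) :
    (fromBlocks (1 : Matrix m m R) 0 (-((2 : R) • E)) (1 - (2 : R) • E) * fromBlocks a b 0 d *
        fromBlocks 1 0 (-((2 : R) • E)) (1 - (2 : R) • E)).toBlocks₂₁ = 0 ↔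
      E * a * (1 - E) = 0 ∧ (1 - E) * d * E = 0 ∧ (2 : R) • (E * b * E) = E * a * E - E * d * E := by
  obtain ⟨c1, c2, c3, c4⟩ := sandwich_corner hE a b d
  rw [toBlocks₂₁_reflFrame_mul_siegel_mul_reflFrame E, eq_zero_iff_sandwich E, c1, c2, c3, c4]
  constructor
  · rintro ⟨h3, h1, h2, -⟩
    refine ⟨eq_zero_of_neg_two_smul_eq_zero h1, eq_zero_of_neg_two_smul_eq_zero h2, ?_⟩
    -- `−2EaE + 4EbE + 2EdE = 0` ⇒ `2EbE = EaE − EdE`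
    have h3' : (⅟ (2 : R)) • (-((2 : R) • (E * a * E)) + (4 : R) • (E * b * E) + (2 : R) • (E * d * E)) = 0 := by rw [h3, smul_zero]
    have h22 : (⅟ (2 : R)) * (4 : R) = 2 := by
      rw [show (4 : R) = 2 * 2 by norm_num, ← mul_assoc, invOf_mul_self, one_mul]
    rw [smul_add, smul_add, smul_neg, smul_smul, smul_smul, smul_smul, invOf_mul_self, one_smul, one_smul, h22] at h3'
    rw [← sub_eq_zero]
    rw [← h3']
    module
  · rintro ⟨h1, h2, h3⟩
    refine ⟨?_, by rw [h1, smul_zero, neg_zero], by rw [h2, smul_zero, neg_zero], rfl⟩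
    have h4 : (4 : R) • (E * b * E) = (2 : R) • ((2 : R) • (E * b * E)) := by
      rw [smul_smul]; norm_num
    rw [h4, h3]
    module

/-! ## §4 The Levi frames `ℓ(a, d) = (a, ⅟2 (a − d); 0, d)` and the parabolic `B_E = M_Δ ∩ w_E⁻¹ P_Δ w_E` -/

omit [DecidableEq m] in
/-- The Levi condition `2b = a − d` on a Siegel frame `(a b; 0 d)` is «`(a b; 0 d)` preserves the frame image `{(x, −2x)}` of `Δ⁻ = {(x, −x)}`»:
`a − 2b = d`, read as `(a b; 0 d)·(x; −2x) = (y; −2y)` with `y = (a − 2b)x = d x`. [cite: MoeglinWaldspurger1995, I.2.1] -/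
theorem leviFrame_apply_antidiag (a d x : Matrix m m R) [Invertible (2 : R)] :
    fromBlocks a ((⅟ (2 : R)) • (a - d)) 0 d * fromBlocks x (0 : Matrix m m R) (-((2 : R) • x)) (0 : Matrix m m R) =
      fromBlocks (d * x) (0 : Matrix m m R) (-((2 : R) • (d * x))) (0 : Matrix m m R) := by
  rw [fromBlocks_multiply, fromBlocks_inj]
  simp only [Matrix.mul_zero, Matrix.zero_mul, add_zero, zero_add, Matrix.mul_neg, Matrix.mul_smul, Matrix.smul_mul, Matrix.sub_mul,
    smul_sub, smul_smul, mul_invOf_self]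
  refine ⟨?_, trivial, trivial, trivial⟩
  module

/-- **`B_E` — the parabolic of the Levi: `w_E ℓ(a,d) w_E ∈ P_Δ ⟺ E a (1 − E) = 0 ∧ (1 − E) d E = 0`** (the third condition of §3 is automatic for
`b = ⅟2(a − d)`): `a` stabilises `ker E` and `d` stabilises `im E`; for `n = 2`, `rank E = 1`, a BOREL of `M_Δ(L⁺) ≅ GL₂(L)` — the index group
`B_E(L⁺)\M_Δ(L⁺)` of the middle term `E₁(s)` of O41.4 and of O41.8's `GL₂` Eisenstein series. [cite: MoeglinWaldspurger1995, II.1.7] -/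
theorem reflConj_leviFrame_siegel_iff [Invertible (2 : R)] {E : Matrix m m R} (hE : E * E = E) (a d : Matrix m m R) :
    (fromBlocks (1 : Matrix m m R) 0 (-((2 : R) • E)) (1 - (2 : R) • E) * fromBlocks a ((⅟ (2 : R)) • (a - d)) 0 d *
        fromBlocks 1 0 (-((2 : R) • E)) (1 - (2 : R) • E)).toBlocks₂₁ = 0 ↔
      E * a * (1 - E) = 0 ∧ (1 - E) * d * E = 0 := by
  rw [reflConj_siegel_siegel_iff hE]
  have h3 : (2 : R) • (E * ((⅟ (2 : R)) • (a - d)) * E) = E * a * E - E * d * E := by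
    rw [Matrix.mul_smul, Matrix.smul_mul, smul_smul, mul_invOf_self, one_smul, Matrix.mul_sub, Matrix.sub_mul]
  exact ⟨fun h => ⟨h.1, h.2.1⟩, fun h => ⟨h.1, h.2, h3⟩⟩

/-- `ℓ(a,d) · n(X) = (a, aX + ⅟2(a − d); 0, d)`. [folklore] -/
theorem leviFrame_mul_unip [Invertible (2 : R)] (a d X : Matrix m m R) :
    fromBlocks a ((⅟ (2 : R)) • (a - d)) 0 d * fromBlocks 1 X 0 1 = fromBlocks a (a * X + (⅟ (2 : R)) • (a - d)) 0 d := by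
  rw [fromBlocks_multiply]
  simp only [Matrix.mul_one, Matrix.zero_mul, add_zero, zero_add, Matrix.mul_zero]

/-- With `E a (1 − E) = 0`: `E a X E = (E a E)(E X E)` — the corner of `X` seen through the invertible-on-`im E` block `E a E`. [folklore] -/
theorem corner_factor {E a : Matrix m m R} (hE : E * E = E) (ha : E * a * (1 - E) = 0) (X : Matrix m m R) :
    E * a * X * E = E * a * E * (E * X * E) := by
  have ha' : E * a = E * a * E := by
    have := ha
    rw [Matrix.mul_sub, Matrix.mul_one, sub_eq_zero] at this
    exact this
  calc E * a * X * E = (E * a * E) * X * E := by rw [← ha']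
    _ = E * a * E * (E * X * E) := by simp only [Matrix.mul_assoc, idem_mul_assoc hE]

/-- **`P_Δ ∩ w_E⁻¹ P_Δ w_E = B_E · N_E`**: `w_E (ℓ(a,d) · n(X)) w_E ∈ P_Δ ⟺ [E a (1−E) = 0 ∧ (1−E) d E = 0] ∧ E a X E = 0`; and by `corner_factor`
the last condition is `E X E = 0` as soon as `E a E` is left-cancellable on `im E` (e.g. `E = e_{i₀}e_{i₀}ᵀ`, `a_{i₀i₀} ∈ Rˣ`).  This is the algebra
behind «the `N_Δ(L⁺)`-orbits of the middle cell are `B_E(L⁺)\M_Δ(L⁺)`, with stabilisers `m⁻¹ N_E m`» (REPORT-FIRST B2 (C2)–(C3)).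
[cite: MoeglinWaldspurger1995, II.1.7] [cite: GelbartPiatetskishapiroRallis1987, Part A §§1–2] -/
theorem reflConj_leviFrame_mul_unip_siegel_iff [Invertible (2 : R)] {E : Matrix m m R} (hE : E * E = E) (a d X : Matrix m m R) :
    (fromBlocks (1 : Matrix m m R) 0 (-((2 : R) • E)) (1 - (2 : R) • E) * (fromBlocks a ((⅟ (2 : R)) • (a - d)) 0 d * fromBlocks 1 X 0 1) *
        fromBlocks 1 0 (-((2 : R) • E)) (1 - (2 : R) • E)).toBlocks₂₁ = 0 ↔
      (E * a * (1 - E) = 0 ∧ (1 - E) * d * E = 0) ∧ E * a * X * E = 0 := by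
  rw [leviFrame_mul_unip, reflConj_siegel_siegel_iff hE]
  have h3 : (2 : R) • (E * (a * X + (⅟ (2 : R)) • (a - d)) * E) = E * a * E - E * d * E ↔ E * a * X * E = 0 := by
    rw [Matrix.mul_add, Matrix.add_mul, smul_add, Matrix.mul_smul, Matrix.smul_mul, smul_smul, mul_invOf_self, one_smul, Matrix.mul_sub,
      Matrix.sub_mul, ← Matrix.mul_assoc, add_eq_right]
    refine ⟨fun h => ?_, fun h => by rw [h, smul_zero]⟩
    have h' : (⅟ (2 : R)) • ((2 : R) • (E * a * X * E)) = 0 := by rw [h, smul_zero]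
    rwa [smul_smul, invOf_mul_self, one_smul] at h'
  rw [h3]
  exact ⟨fun h => ⟨⟨h.1, h.2.1⟩, h.2.2⟩, fun h => ⟨h.1.1, h.1.2, h.2⟩⟩

/-! ## §5 The corner of `w_E · S`: the representatives `w_E m` stay in the `rank E` cell -/

/-- **The corner of `W_E · (a b; 0 d)` is `−2 E a`** (for a Levi representative `w_E ℓ(a,d)`: rank `= rank (E a) = rank E` when `a` is invertible).
[cite: GelbartPiatetskishapiroRallis1987, Part A §1] -/
theorem toBlocks₂₁_reflFrame_mul_siegel (E a b d : Matrix m m R) :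
    (fromBlocks (1 : Matrix m m R) 0 (-((2 : R) • E)) (1 - (2 : R) • E) * fromBlocks a b 0 d).toBlocks₂₁ = -((2 : R) • (E * a)) := by
  rw [fromBlocks_multiply, toBlocks_fromBlocks₂₁, Matrix.neg_mul, Matrix.smul_mul, Matrix.mul_zero, add_zero]

/-- … and of `(a b; 0 d) · W_E` it is `−2 d E`. [cite: GelbartPiatetskishapiroRallis1987, Part A §1] -/
theorem toBlocks₂₁_siegel_mul_reflFrame (E a b d : Matrix m m R) :
    (fromBlocks a b 0 d * fromBlocks (1 : Matrix m m R) 0 (-((2 : R) • E)) (1 - (2 : R) • E)).toBlocks₂₁ = -((2 : R) • (d * E)) := by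
  rw [fromBlocks_multiply, toBlocks_fromBlocks₂₁, Matrix.zero_mul, zero_add, Matrix.mul_neg, Matrix.mul_smul]

end Summit.HodgeConjecture.HodgeConjecture.Cruxes.HLiu418.K2LiuSiegelBruhatMiddleCell
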